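/- WIDTH seat `ym-line-cbag-p1-w2` (prover-ym-line-cbag-p1-w2-g23-0), LINE 7b `GlueballBandRecursion` (volume comparison → rung), in
support of ⟨stmt-QuantumFields-22957⟩: the TORUS SLAB LEMMA on the LEAD's encoding (piece C2 proper, part 1): a closed family of labels of
the periodic box `BoxLabel n` crosses every crossed slab with at least four plaquettes.  Definition-free; route-independent; a helper. -/
import Literature.MathematicalPhysics.QuantumFieldTheory.PeriodicBoxRotation
import Summits.QuantumFields.YangMills.Theorems.GlueballBandRecursionSlabGirthCore

/-!
# Route `GlueballBandRecursion`, LINE 7b: the slab lemma on the periodic box — four plaquettes per crossed slab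

Encoding (the tree's, fixed by `Theorems/GlueballBandRecursionThermalFreeEnergyDefs.lean`: the thermal free energy is the cluster-expansion
logarithm of `boxSystem ρ ![a,a,a,t]`): labels `p = (x, μ<ν) : BoxLabel n` of the anisotropic periodic box of sizes `n : Fin d → ℕ`, bonds
`BoxLabel.bonds p = {(x,μ), (x+e_μ,ν), (x+e_ν,μ), (x,ν)}` read in `ℤ^d` through the section, `BoxLabel.coord i p = x i`.  A label CROSSES the slab of
direction `i` at level `k` if its plane contains `i` and `coord i p = k` (its two direction-`i` bonds are based at `x` and at `x + e_{ν'}`, `ν'` the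
other direction of its plane).  A finite family `A` is CLOSED if every bond of every member lies in another member
(`∀ p ∈ A, ∀ e ∈ p.bonds, ∃ q ∈ A, q ≠ p ∧ e ∈ q.bonds` — the no-free-bond condition of the width seat w4's `SupportExpansion` and of the LEAD's
stub `Thermal.ThermalFreeEnergyVolumeJets`).

* §1 the section into the discrete torus `Π j, ZMod (n j)`: `torusPt x := (j ↦ (x j : ZMod (n j)))`, `torusPt (shift ν x) = torusPt x + e_ν`,
  injectivity; the direction-`i` bonds of a label: membership (`toEdge_mem_bonds_of_cross`, `toEdge_shift_mem_bonds_of_cross`) and the converse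
  (`cross_of_toEdge_mem_bonds`: a label containing the bond `(y, i)` crosses direction `i` at level `y i`, with `y` one of its two endpoints);
* §2 **`four_le_card_filter_cross`** — if all sides are `≥ 4` and `A` is closed, every slab `(i, k)` met by an `i`-crossing member of `A` is met by
  at least FOUR of them (the crossing members, read as edges `{ȳ, ȳ + e_{ν'}}` of the cross-section torus, form an edge set with all touched vertices
  of degree `≥ 2`, and the torus with sides `≥ 4` has girth `4`: `SlabGirth.four_le_card_torusEdges`); `three_le_card_filter_cross` for sides `≥ 3`.
The companion `Theorems/GlueballBandRecursionClosedRooting.lean` turns this into the linear size bound / rooting of closed connected supports.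

HONEST FRAMING.  Finite combinatorics; item 22957, the volume comparison, LINE 7's RECORD rung `ColdDoublingRecursionStrongCoupling` and the
Yang–Mills mass gap / summit `YangMills` are NOT proved or advanced here.
-/

set_option autoImplicit false

namespace Summit.QuantumFields.YangMills.Theorems.GlueballBandRecursion.SlabCount

open Literature.MathematicalPhysics.QuantumFieldTheory
open Literature.MathematicalPhysics.QuantumFieldTheory.BoxSite (toEdge shift)

variable {d : ℕ} {n : Fin d → ℕ}

/-! ## §1 The section into the discrete torus and the direction-`i` bonds of a label -/

/-- A side carrying a site is positive. -/
theorem size_pos (x : BoxSite n) (j : Fin d) : 0 < n j := Fin.pos (x j)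

/-- The section `BoxSite n → Π j, ZMod (n j)` intertwines the periodic shift with the unit step: `(x + e_ν)‾ = x̄ + e_ν`. -/
theorem torusPt_shift (ν : Fin d) (x : BoxSite n) :
    (fun j => (((shift ν x) j : ℕ) : ZMod (n j))) = (fun j => ((x j : ℕ) : ZMod (n j))) + Pi.single ν 1 := by
  funext j
  by_cases h : j = ν
  · subst h
    rw [Pi.add_apply, Pi.single_eq_same]
    simp only [BoxSite.shift, Function.update_self,
      Literature.GroupTheory.CombinatorialGroupTheory.val_finRotate (size_pos x j), ZMod.natCast_mod, Nat.cast_add,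
      Nat.cast_one]
  · rw [Pi.add_apply, Pi.single_eq_of_ne h, add_zero]
    simp only [BoxSite.shift, Function.update_of_ne h]

/-- The section `BoxSite n → Π j, ZMod (n j)` is injective. -/
theorem eq_of_torusPt_eq {x y : BoxSite n}
    (h : (fun j => ((x j : ℕ) : ZMod (n j))) = fun j => ((y j : ℕ) : ZMod (n j))) : x = y := by
  funext j
  have hj : ((x j : ℕ) : ZMod (n j)) = ((y j : ℕ) : ZMod (n j)) := congrFun h j
  rw [ZMod.natCast_eq_natCast_iff', Nat.mod_eq_of_lt (x j).isLt, Nat.mod_eq_of_lt (y j).isLt] at hj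
  exact Fin.ext hj

/-- The first direction-`i` bond of an `i`-crossing label: `(x, i) ∈ bonds p`. -/
theorem toEdge_mem_bonds_of_cross {i : Fin d} {p : BoxLabel n} (hp : p.2.1.1 = i ∨ p.2.1.2 = i) :
    toEdge p.1 i ∈ p.bonds := by
  rcases hp with h | h
  · rw [← h]; simp [BoxLabel.bonds]
  · rw [← h]; simp [BoxLabel.bonds]

/-- The second direction-`i` bond of an `i`-crossing label: `(x + e_{ν'}, i) ∈ bonds p`, `ν'` the other direction of the plane. -/
theorem toEdge_shift_mem_bonds_of_cross {i : Fin d} {p : BoxLabel n} (hp : p.2.1.1 = i ∨ p.2.1.2 = i) :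
    toEdge (shift (if p.2.1.1 = i then p.2.1.2 else p.2.1.1) p.1) i ∈ p.bonds := by
  by_cases h1 : p.2.1.1 = i
  · rw [if_pos h1, ← h1]; simp [BoxLabel.bonds]
  · have h2 : p.2.1.2 = i := hp.resolve_left h1
    rw [if_neg h1, ← h2]; simp [BoxLabel.bonds]

/-- The other direction of the plane of a label (relative to `i`) is not `i`. -/
theorem otherDir_ne (i : Fin d) (p : BoxLabel n) :
    (if p.2.1.1 = i then p.2.1.2 else p.2.1.1) ≠ i := by
  have hlt : p.2.1.1 < p.2.1.2 := p.2.2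
  by_cases h1 : p.2.1.1 = i
  · rw [if_pos h1]; intro h; rw [h1, h] at hlt; exact lt_irrefl _ hlt
  · rw [if_neg h1]; exact h1

/-- **A label containing the bond `(y, i)` crosses direction `i` at level `y i`, with `y` one of its two direction-`i` endpoints.** -/
theorem cross_of_toEdge_mem_bonds {i : Fin d} {p : BoxLabel n} {y : BoxSite n} (h : toEdge y i ∈ p.bonds) :
    (p.2.1.1 = i ∨ p.2.1.2 = i) ∧ (y = p.1 ∨ y = shift (if p.2.1.1 = i then p.2.1.2 else p.2.1.1) p.1) ∧
      BoxLabel.coord i p = (y i : ℕ) := by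
  have hlt : p.2.1.1 < p.2.1.2 := p.2.2
  have hne : p.2.1.1 ≠ p.2.1.2 := ne_of_lt hlt
  simp only [BoxLabel.bonds, Finset.mem_insert, Finset.mem_singleton, BoxSite.toEdge_inj] at h
  rcases h with ⟨rfl, h⟩ | ⟨rfl, h⟩ | ⟨rfl, h⟩ | ⟨rfl, h⟩
  · exact ⟨Or.inl h.symm, Or.inl rfl, rfl⟩
  · have h1 : ¬ p.2.1.1 = i := fun h1 => hne (h1.trans h)
    have h1' : i ≠ p.2.1.1 := fun hi => h1 hi.symm
    refine ⟨Or.inr h.symm, Or.inr ?_, ?_⟩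
    · rw [if_neg h1]
    · simp only [BoxLabel.coord, BoxSite.shift, Function.update_of_ne h1']
  · have h2' : i ≠ p.2.1.2 := fun hi => hne (h.symm.trans hi)
    refine ⟨Or.inl h.symm, Or.inr ?_, ?_⟩
    · rw [if_pos h.symm]
    · simp only [BoxLabel.coord, BoxSite.shift, Function.update_of_ne h2']
  · exact ⟨Or.inr h.symm, Or.inl rfl, rfl⟩

/-- Two `i`-crossing labels with the same base site and the same other direction coincide. -/
theorem eq_of_cross_of_base_eq {i : Fin d} {p q : BoxLabel n} (hp : p.2.1.1 = i ∨ p.2.1.2 = i) (hq : q.2.1.1 = i ∨ q.2.1.2 = i)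
    (hbase : p.1 = q.1)
    (hdir : (if p.2.1.1 = i then p.2.1.2 else p.2.1.1) = (if q.2.1.1 = i then q.2.1.2 else q.2.1.1)) : p = q := by
  have hp' : p.2.1.1 < p.2.1.2 := p.2.2
  have hq' : q.2.1.1 < q.2.1.2 := q.2.2
  refine Prod.ext hbase (Subtype.ext (Prod.ext ?_ ?_))
  · by_cases h1 : p.2.1.1 = i <;> by_cases h2 : q.2.1.1 = i
    · rw [h1, h2]
    · rw [if_pos h1, if_neg h2] at hdir
      have := hq.resolve_left h2
      omega
    · rw [if_neg h1, if_pos h2] at hdir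
      have := hp.resolve_left h1
      omega
    · rw [if_neg h1, if_neg h2] at hdir; exact hdir
  · by_cases h1 : p.2.1.1 = i <;> by_cases h2 : q.2.1.1 = i
    · rw [if_pos h1, if_pos h2] at hdir; exact hdir
    · rw [if_pos h1, if_neg h2] at hdir
      have := hq.resolve_left h2
      omega
    · rw [if_neg h1, if_pos h2] at hdir
      have := hp.resolve_left h1
      omega
    · have e1 := hp.resolve_left h1
      have e2 := hq.resolve_left h2
      rw [e1, e2]

/-! ## §2 Four plaquettes per crossed slab -/

/-- **The torus slab lemma (sides `≥ 4`).**  Let all sides of the periodic box be `≥ 4` and let `A` be a CLOSED family of labels (every bond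
of every member lies in another member).  If `A` has a member whose plane contains the direction `i`, based at `i`-level `k`, then it has at
least FOUR such members: «four plaquettes in every crossed slab». -/
theorem four_le_card_filter_cross [DecidableEq (BoxLabel n)] (hn : ∀ j, 4 ≤ n j) {A : Finset (BoxLabel n)}
    (hclosed : ∀ p ∈ A, ∀ e ∈ p.bonds, ∃ q ∈ A, q ≠ p ∧ e ∈ q.bonds) (i : Fin d) (k : ℕ)
    (hex : ∃ p ∈ A, (p.2.1.1 = i ∨ p.2.1.2 = i) ∧ BoxLabel.coord i p = k) :
    4 ≤ (A.filter fun p => (p.2.1.1 = i ∨ p.2.1.2 = i) ∧ BoxLabel.coord i p = k).card := by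
  classical
  set E := A.filter fun p => (p.2.1.1 = i ∨ p.2.1.2 = i) ∧ BoxLabel.coord i p = k with hE
  -- the cross-section edge of a crossing label: base point `x̄`, direction `ν'`
  set base : BoxLabel n → ((j : Fin d) → ZMod (n j)) := fun p j => ((p.1 j : ℕ) : ZMod (n j)) with hbase
  set dir : BoxLabel n → Fin d := fun p => if p.2.1.1 = i then p.2.1.2 else p.2.1.1 with hdir
  have hends : ∀ p : BoxLabel n, base p + Pi.single (dir p) 1 = fun j => (((shift (dir p) p.1) j : ℕ) : ZMod (n j)) :=
    fun p => (torusPt_shift (dir p) p.1).symm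
  refine SlabGirth.four_le_card_torusEdges hn base dir (fun e₁ h₁ e₂ h₂ hb hd => ?_) (fun e he v hv => ?_)
    (by obtain ⟨p, hpA, hp⟩ := hex; exact ⟨p, Finset.mem_filter.2 ⟨hpA, hp⟩⟩)
  · -- injectivity of (base, dir) on crossing labels
    have hc₁ := (Finset.mem_filter.1 h₁).2.1
    have hc₂ := (Finset.mem_filter.1 h₂).2.1
    exact eq_of_cross_of_base_eq hc₁ hc₂ (eq_of_torusPt_eq hb) hd
  · -- degree ≥ 2 from closedness: the endpoint `v` is the bond `(y, i)` of `e`, which lies in another member `q`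
    obtain ⟨heA, hecross, hek⟩ := Finset.mem_filter.1 he
    -- the site `y` under the endpoint `v`
    obtain ⟨y, hyv, hyb⟩ : ∃ y : BoxSite n, v = (fun j => ((y j : ℕ) : ZMod (n j))) ∧ toEdge y i ∈ e.bonds := by
      simp only [Finset.mem_insert, Finset.mem_singleton] at hv
      rcases hv with rfl | rfl
      · exact ⟨e.1, rfl, toEdge_mem_bonds_of_cross hecross⟩
      · exact ⟨shift (dir e) e.1, hends e, toEdge_shift_mem_bonds_of_cross hecross⟩
    obtain ⟨q, hqA, hqe, hyq⟩ := hclosed e heA _ hyb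
    obtain ⟨hqcross, hyend, hqk⟩ := cross_of_toEdge_mem_bonds hyq
    -- `q` crosses the same slab: its level is `y i = coord i e = k`
    have hylev : (y i : ℕ) = k := by
      obtain ⟨-, hyend', hek'⟩ := cross_of_toEdge_mem_bonds hyb
      rw [← hek, hek']
    refine ⟨q, Finset.mem_filter.2 ⟨hqA, hqcross, by rw [hqk, hylev]⟩, hqe, ?_⟩
    simp only [Finset.mem_insert, Finset.mem_singleton]
    rcases hyend with rfl | rfl
    · exact Or.inl hyv
    · exact Or.inr (by rw [hyv, hends q])

/-- **The torus slab lemma (sides `≥ 3`): at least three plaquettes per crossed slab.** -/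
theorem three_le_card_filter_cross [DecidableEq (BoxLabel n)] (hn : ∀ j, 3 ≤ n j) {A : Finset (BoxLabel n)}
    (hclosed : ∀ p ∈ A, ∀ e ∈ p.bonds, ∃ q ∈ A, q ≠ p ∧ e ∈ q.bonds) (i : Fin d) (k : ℕ)
    (hex : ∃ p ∈ A, (p.2.1.1 = i ∨ p.2.1.2 = i) ∧ BoxLabel.coord i p = k) :
    3 ≤ (A.filter fun p => (p.2.1.1 = i ∨ p.2.1.2 = i) ∧ BoxLabel.coord i p = k).card := by
  classical
  set base : BoxLabel n → ((j : Fin d) → ZMod (n j)) := fun p j => ((p.1 j : ℕ) : ZMod (n j)) with hbase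
  set dir : BoxLabel n → Fin d := fun p => if p.2.1.1 = i then p.2.1.2 else p.2.1.1 with hdir
  have hends : ∀ p : BoxLabel n, base p + Pi.single (dir p) 1 = fun j => (((shift (dir p) p.1) j : ℕ) : ZMod (n j)) :=
    fun p => (torusPt_shift (dir p) p.1).symm
  refine SlabGirth.three_le_card_torusEdges hn base dir (fun e₁ h₁ e₂ h₂ hb hd => ?_) (fun e he v hv => ?_)
    (by obtain ⟨p, hpA, hp⟩ := hex; exact ⟨p, Finset.mem_filter.2 ⟨hpA, hp⟩⟩)
  · have hc₁ := (Finset.mem_filter.1 h₁).2.1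
    have hc₂ := (Finset.mem_filter.1 h₂).2.1
    exact eq_of_cross_of_base_eq hc₁ hc₂ (eq_of_torusPt_eq hb) hd
  · obtain ⟨heA, hecross, hek⟩ := Finset.mem_filter.1 he
    obtain ⟨y, hyv, hyb⟩ : ∃ y : BoxSite n, v = (fun j => ((y j : ℕ) : ZMod (n j))) ∧ toEdge y i ∈ e.bonds := by
      simp only [Finset.mem_insert, Finset.mem_singleton] at hv
      rcases hv with rfl | rfl
      · exact ⟨e.1, rfl, toEdge_mem_bonds_of_cross hecross⟩
      · exact ⟨shift (dir e) e.1, hends e, toEdge_shift_mem_bonds_of_cross hecross⟩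
    obtain ⟨q, hqA, hqe, hyq⟩ := hclosed e heA _ hyb
    obtain ⟨hqcross, hyend, hqk⟩ := cross_of_toEdge_mem_bonds hyq
    have hylev : (y i : ℕ) = k := by
      obtain ⟨-, -, hek'⟩ := cross_of_toEdge_mem_bonds hyb
      rw [← hek, hek']
    refine ⟨q, Finset.mem_filter.2 ⟨hqA, hqcross, by rw [hqk, hylev]⟩, hqe, ?_⟩
    simp only [Finset.mem_insert, Finset.mem_singleton]
    rcases hyend with rfl | rfl
    · exact Or.inl hyv
    · exact Or.inr (by rw [hyv, hends q])

end Summit.QuantumFields.YangMills.Theorems.GlueballBandRecursion.SlabCount
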